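import Mathlib.MeasureTheory.Constructions.Polish.Basic
import Literature.Probability.RandomPlanarGeometry.ConformalRestrictionProofs
import Literature.Probability.RandomPlanarGeometry.SimpleCurves
import HarnessLib

/-!
# Laws of random simple curves are determined by the avoidance probabilities of their trace

The last step of both halves of [LSW] p. 5 result 2 (`Literature.Probability.RandomPlanarGeometry.LawlerSchrammWerner2003`,
decomposed in `ConformalRestrictionProofs`):

* G. F. Lawler, O. Schramm, W. Werner, *Conformal restriction: the chordal case*, J. Amer. Math.
  Soc. **16** (2003) 917–955, arXiv:math/0209343 (**[LSW]**),

works with random SETS `K` (Def. 3.1: the σ-algebra on `Ω` is generated by the avoidance events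
`{K ∩ A = ∅}`; Lemma 3.2, p. 10: a probability measure on `Ω` is determined by its avoidance
probabilities `P[K ∩ A = ∅]`, a π-system argument), whereas the tree's statement is about laws
on the space `CurveClass ℂ` of curves modulo increasing reparametrisation. The bridge, implicit
in [LSW] p. 5 ("the only measure `P_α` supported on simple curves … is the law of chordal
SLE_{8/3}"), is the following theorem of descriptive set theory, PROVED here in a general metric
space `E`:

* `Literature.Probability.RandomPlanarGeometry.CurveClass.eq_of_mem_simple_of_range_eq` — a SIMPLE curve class is determined by its
  trace and its starting point (two injective parametrisations of the same arc with the same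
  starting point differ by an increasing homeomorphism of `[0, 1]`: invert one of them, a
  homeomorphism onto the arc by compactness, and use that a self-homeomorphism of `[0, 1]`
  fixing `0` is increasing);
* `Literature.Probability.RandomPlanarGeometry.CurveClass.Measure.ext_of_missCode_injOn` — abstract transfer: if two finite Borel
  measures on `CurveClass E` are carried by a Borel set `R` on which the *avoidance code*
  `c ↦ (𝟙[c.range ∩ C n = ∅])ₙ` of a sequence of closed test sets `C n` is injective, and they
  give the same mass to the avoidance events `{c | c.range ∩ (C n₁ ∪ … ∪ C nₖ) = ∅}` (`k = 0`
  gives the whole space), they are equal. Proof: by the Lusin–Souslin theorem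
  (`MeasurableSet.image_of_measurable_injOn`; `CurveClass E` is Polish, `CurveSpace`) every Borel
  `T ⊆ R` is `R ∩ code⁻¹(B)` for a Borel `B ⊆ (ℕ → Bool)`, so `μ T = code_* μ (B)`; and the two
  image measures on `ℕ → Bool` agree on the π-system of positive cylinders, which generates the
  product σ-algebra (`MeasureTheory.ext_of_generate_finite`);
* `Literature.Probability.RandomPlanarGeometry.CurveClass.Measure.ext_of_simple` — metric form: two finite Borel measures on
  `CurveClass E` (`E` complete separable metric) carried by simple classes with a common
  starting point `a`, which agree on all avoidance events `{c | c.range ∩ C = ∅}`, `C` closed,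
  are equal (test sets: closed balls of radii `1/(k+1)` centred on a dense sequence, which
  separate points from compact sets).

The abstract form is the one needed on Dobrushin domains, where the available test sets are the
hulls `D̄ ∖ D'` of hull subdomains (`MarkedDomain.IsHullSubdomain`), whose avoidance events are
the `CurveClass.rangeSubset (closure D')` of `ChordalFamily.IsHullRestriction`; that these
separate simple traces from `a` to `b` meeting `∂D` only at `a`, `b` is [LSW] Lemma 3.2's remark
"this σ-field is the same as the Borel σ-field" (p. 10), a plane-topology statement left to the
transposition step.

Mathlib: `MeasurableSet.image_of_measurable_injOn` (Lusin–Souslin), `StandardBorelSpace`,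
`MeasureTheory.ext_of_generate_finite`, `Continuous.homeoOfEquivCompactToT2`,
`Continuous.strictMono_of_inj_boundedOrder`, `StrictMono.orderIsoOfSurjective`. Tree:
`CurveClass.measurableSet_simple'` (`SimpleCurves`: simplicity is a Borel event in every metric
space), `CurveClass.measurableSet_rangeSubset_of_isOpen` (`ConformalRestrictionProofs`).
-/

noncomputable section

open Set Filter Topology MeasureTheory
open scoped unitInterval

namespace Literature.Probability.RandomPlanarGeometry

variable {E : Type*}

/-! ### A simple class is determined by its trace and its starting point -/

namespace Curve

variable [MetricSpace E]

/-- An injective curve is a homeomorphism of `[0, 1]` onto its trace (a continuous bijection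
from a compact space to a Hausdorff space). [folklore] -/
def IsSimple.homeomorphRange {γ : Curve E} (h : γ.IsSimple) : I ≃ₜ Set.range γ :=
  Continuous.homeoOfEquivCompactToT2 (f := Equiv.ofInjective γ h)
    (continuous_induced_rng.2 (by exact γ.continuous))

/-- The homeomorphism onto the trace is the curve. [folklore] -/
@[simp] theorem IsSimple.coe_homeomorphRange_apply {γ : Curve E} (h : γ.IsSimple) (t : I) :
    (h.homeomorphRange t : E) = γ t := rfl

/-- **Two injective parametrisations of the same arc with the same starting point differ by an
increasing homeomorphism of `[0, 1]`.** The self-map `ψ = γ₂⁻¹ ∘ γ₁` of `[0, 1]` is a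
homeomorphism fixing `0`, hence increasing (`Continuous.strictMono_of_inj_boundedOrder`), and
`γ₁ = γ₂ ∘ ψ`. [folklore] -/
theorem IsSimple.exists_eq_reparam {γ₁ γ₂ : Curve E} (h₁ : γ₁.IsSimple) (h₂ : γ₂.IsSimple)
    (hr : γ₁.range = γ₂.range) (hs : γ₁.source = γ₂.source) :
    ∃ φ : I ≃o I, γ₁ = γ₂.reparam φ := by
  have hr' : Set.range γ₁ = Set.range γ₂ := hr
  let ψ : I ≃ₜ I :=
    h₁.homeomorphRange.trans ((Homeomorph.setCongr hr').trans h₂.homeomorphRange.symm)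
  have hψ : ∀ t, γ₂ (ψ t) = γ₁ t := fun t ↦ by
    have h := h₂.coe_homeomorphRange_apply (h₂.homeomorphRange.symm
      (Homeomorph.setCongr hr' (h₁.homeomorphRange t)))
    rw [Homeomorph.apply_symm_apply] at h
    exact h.symm
  have hψ0 : ψ 0 = 0 := h₂ (by rw [hψ]; exact hs)
  have hmono : StrictMono ψ :=
    ψ.continuous.strictMono_of_inj_boundedOrder
      (by rw [show (⊥ : I) = 0 from rfl, hψ0]; exact bot_le) ψ.injective
  refine ⟨hmono.orderIsoOfSurjective ψ ψ.surjective, ?_⟩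
  ext t
  exact (hψ t).symm

end Curve

namespace CurveClass

section Determined

variable [MetricSpace E]

/-- **A simple curve class is determined by its trace and its starting point.** [folklore] -/
theorem eq_of_mem_simple_of_range_eq {c₁ c₂ : CurveClass E} (h₁ : c₁ ∈ simple)
    (h₂ : c₂ ∈ simple) (hr : c₁.range = c₂.range) (hs : c₁.source = c₂.source) : c₁ = c₂ := by
  obtain ⟨γ₁, hγ₁, rfl⟩ := h₁
  obtain ⟨γ₂, hγ₂, rfl⟩ := h₂
  obtain ⟨φ, rfl⟩ := Curve.IsSimple.exists_eq_reparam hγ₁ hγ₂ hr hs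
  exact mk_reparam γ₂ φ

/-- On simple classes with a fixed starting point, the trace is injective. [folklore] -/
theorem injOn_range_simple (a : E) :
    InjOn range (simple ∩ {c : CurveClass E | c.source = a}) :=
  fun _ h₁ _ h₂ h ↦ eq_of_mem_simple_of_range_eq h₁.1 h₂.1 h (h₁.2.trans h₂.2.symm)

end Determined

/-! ### Avoidance events and the avoidance code of a sequence of test sets -/

section Code

variable [MetricSpace E]

/-- The trace avoids `C` iff it stays in `Cᶜ`: the avoidance event `{c | c.range ∩ C = ∅}` is
`rangeSubset Cᶜ`. [folklore] -/
theorem disjoint_range_iff {c : CurveClass E} {C : Set E} :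
    Disjoint c.range C ↔ c ∈ rangeSubset Cᶜ :=
  subset_compl_iff_disjoint_right.symm

/-- Avoiding a closed set is an open, hence Borel, event. [folklore] -/
theorem measurableSet_rangeSubset_compl {C : Set E} (hC : IsClosed C) :
    MeasurableSet (rangeSubset Cᶜ : Set (CurveClass E)) :=
  measurableSet_rangeSubset_of_isOpen hC.isOpen_compl

/-- The **avoidance code** of a curve class with respect to a sequence of test sets `C n`: the
sequence of Booleans "the trace avoids `C n`". ([LSW] Def. 3.1 / Lemma 3.2: the events
`{K ∩ A = ∅}` generate the σ-algebra.) [folklore] -/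
def missCode (C : ℕ → Set E) (c : CurveClass E) (n : ℕ) : Bool :=
  @decide (Disjoint c.range (C n)) (Classical.dec _)

/-- The `n`-th letter of the avoidance code is `true` iff the trace avoids `C n`. [folklore] -/
theorem missCode_eq_true_iff {C : ℕ → Set E} {c : CurveClass E} {n : ℕ} :
    missCode C c n = true ↔ Disjoint c.range (C n) := by
  unfold missCode
  exact @decide_eq_true_iff _ (Classical.dec _)

/-- The avoidance code of a sequence of closed test sets is Borel measurable. [folklore] -/
theorem measurable_missCode {C : ℕ → Set E} (hC : ∀ n, IsClosed (C n)) :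
    Measurable (missCode C : CurveClass E → ℕ → Bool) := by
  refine measurable_pi_iff.2 fun n ↦ measurable_to_countable' fun b ↦ ?_
  have h : (fun c : CurveClass E ↦ missCode C c n) ⁻¹' {true} = rangeSubset (C n)ᶜ := by
    ext c
    rw [mem_preimage, mem_singleton_iff, missCode_eq_true_iff, disjoint_range_iff]
  cases b
  · have h' : (fun c : CurveClass E ↦ missCode C c n) ⁻¹' {false} = (rangeSubset (C n)ᶜ)ᶜ := by
      rw [← h]
      ext c
      simp
    rw [h']
    exact (measurableSet_rangeSubset_compl (hC n)).compl
  · rw [h]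
    exact measurableSet_rangeSubset_compl (hC n)

/-- The **positive cylinder** of a finite set `s` of indices: Boolean sequences equal to `true`
on `s`. [folklore] -/
def posCylinder (s : Finset ℕ) : Set (ℕ → Bool) := {f | ∀ n ∈ s, f n = true}

/-- Positive cylinders are measurable for the product σ-algebra. [folklore] -/
theorem measurableSet_posCylinder (s : Finset ℕ) : MeasurableSet (posCylinder s) := by
  have h : posCylinder s = ⋂ n ∈ s, Function.eval n ⁻¹' {true} := by
    ext f
    simp [posCylinder]
  rw [h]
  exact Finset.measurableSet_biInter s fun n _ ↦ measurable_pi_apply n (measurableSet_singleton _)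

/-- Positive cylinders form a π-system (`posCylinder s ∩ posCylinder t = posCylinder (s ∪ t)`). [folklore] -/
theorem isPiSystem_posCylinder : IsPiSystem (Set.range posCylinder) := by
  rintro _ ⟨s, rfl⟩ _ ⟨t, rfl⟩ -
  refine ⟨s ∪ t, ?_⟩
  ext f
  simp only [posCylinder, Finset.mem_union, mem_setOf_eq, mem_inter_iff]
  exact ⟨fun h ↦ ⟨fun n hn ↦ h n (Or.inl hn), fun n hn ↦ h n (Or.inr hn)⟩,
    fun h n hn ↦ hn.elim (h.1 n) (h.2 n)⟩

/-- The positive cylinders generate the product σ-algebra of `ℕ → Bool` (a coordinate event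
`{f | f n = b}` is a positive cylinder or the complement of one). [folklore] -/
theorem generateFrom_posCylinder :
    MeasurableSpace.generateFrom (Set.range posCylinder) =
      (MeasurableSpace.pi : MeasurableSpace (ℕ → Bool)) := by
  refine le_antisymm (MeasurableSpace.generateFrom_le ?_) ?_
  · rintro _ ⟨s, rfl⟩
    exact measurableSet_posCylinder s
  · rw [MeasurableSpace.pi_eq_generateFrom_projections]
    refine MeasurableSpace.generateFrom_le ?_
    rintro _ ⟨n, A, -, rfl⟩
    have htrue : MeasurableSet[MeasurableSpace.generateFrom (Set.range posCylinder)]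
        (Function.eval n ⁻¹' ({true} : Set Bool) : Set (ℕ → Bool)) := by
      refine MeasurableSpace.measurableSet_generateFrom ⟨{n}, ?_⟩
      ext f
      simp [posCylinder]
    have hA : (Function.eval n ⁻¹' A : Set (ℕ → Bool)) =
        ⋃ b ∈ A, (Function.eval n ⁻¹' ({b} : Set Bool) : Set (ℕ → Bool)) := by
      ext f
      simp
    rw [hA]
    refine MeasurableSet.biUnion A.to_countable fun b _ ↦ ?_
    cases b
    · have h : (Function.eval n ⁻¹' ({false} : Set Bool) : Set (ℕ → Bool)) =
          (Function.eval n ⁻¹' ({true} : Set Bool))ᶜ := by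
        ext f
        simp
      rw [h]
      exact htrue.compl
    · exact htrue

/-- The avoidance code lands in the positive cylinder of `s` iff the trace avoids the finite
union `⋃ n ∈ s, C n`. [folklore] -/
theorem missCode_preimage_posCylinder (C : ℕ → Set E) (s : Finset ℕ) :
    (missCode C : CurveClass E → ℕ → Bool) ⁻¹' posCylinder s =
      rangeSubset (⋃ n ∈ s, C n)ᶜ := by
  ext c
  simp only [mem_preimage, posCylinder, mem_setOf_eq, missCode_eq_true_iff, mem_rangeSubset,
    subset_compl_iff_disjoint_right, disjoint_iUnion₂_right]

/-- The avoidance event of the empty finite union is the whole space. [folklore] -/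
@[simp] theorem rangeSubset_compl_biUnion_empty (C : ℕ → Set E) :
    (rangeSubset (⋃ n ∈ (∅ : Finset ℕ), C n)ᶜ : Set (CurveClass E)) = univ := by
  refine eq_univ_of_forall fun c ↦ ?_
  simp [mem_rangeSubset]

end Code

/-! ### Transfer: measures carried by a set on which the avoidance code is injective -/

namespace Measure

variable [MetricSpace E] [CompleteSpace E] [SecondCountableTopology E]

/-- **Abstract transfer theorem.** Let `C n` be closed test sets and `R` a Borel set of curve
classes on which the avoidance code `missCode C` is injective. Two finite Borel measures on
`CurveClass E` carried by `R` with the same mass on every avoidance event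
`{c | c.range ∩ ⋃ n ∈ s, C n = ∅}` (`s` finite; `s = ∅` is the total mass) are equal.
Lusin–Souslin (`CurveClass E` is Polish) plus uniqueness of measures on the π-system of positive
cylinders of `ℕ → Bool`; this is the curve-space form of [LSW] Lemma 3.2 (p. 10). [folklore] -/
theorem ext_of_missCode_injOn {C : ℕ → Set E} (hC : ∀ n, IsClosed (C n))
    {R : Set (CurveClass E)} (hR : MeasurableSet R) (hinj : InjOn (missCode C) R)
    {μ ν : Measure (CurveClass E)} [IsFiniteMeasure μ] [IsFiniteMeasure ν]
    (hμ : ∀ᵐ c ∂μ, c ∈ R) (hν : ∀ᵐ c ∂ν, c ∈ R)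
    (h : ∀ s : Finset ℕ, μ (rangeSubset (⋃ n ∈ s, C n)ᶜ) = ν (rangeSubset (⋃ n ∈ s, C n)ᶜ)) :
    μ = ν := by
  have huniv : μ univ = ν univ := by simpa only [rangeSubset_compl_biUnion_empty] using h ∅
  have hF : Measurable (missCode C : CurveClass E → ℕ → Bool) := measurable_missCode hC
  -- the two image measures on `ℕ → Bool` agree
  have hmap : μ.map (missCode C) = ν.map (missCode C) := by
    refine ext_of_generate_finite (Set.range posCylinder) generateFrom_posCylinder.symm
      isPiSystem_posCylinder ?_ ?_
    · rintro _ ⟨s, rfl⟩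
      rw [Measure.map_apply hF (measurableSet_posCylinder s),
        Measure.map_apply hF (measurableSet_posCylinder s), missCode_preimage_posCylinder]
      exact h s
    · rw [Measure.map_apply hF MeasurableSet.univ, Measure.map_apply hF MeasurableSet.univ,
        preimage_univ]
      exact huniv
  -- restrict to `R` and pull Borel sets back from the code space (Lusin–Souslin)
  have hμR : μ.restrict R = μ := Measure.restrict_eq_self_of_ae_mem hμ
  have hνR : ν.restrict R = ν := Measure.restrict_eq_self_of_ae_mem hν
  ext T hT
  have hB : MeasurableSet (missCode C '' (T ∩ R)) :=
    (hT.inter hR).image_of_measurable_injOn hF (hinj.mono inter_subset_right)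
  have hpre : missCode C ⁻¹' (missCode C '' (T ∩ R)) ∩ R = T ∩ R :=
    hinj.preimage_image_inter inter_subset_right
  calc μ T = μ (T ∩ R) := by rw [← Measure.restrict_apply hT, hμR]
    _ = μ (missCode C ⁻¹' (missCode C '' (T ∩ R)) ∩ R) := by rw [hpre]
    _ = μ (missCode C ⁻¹' (missCode C '' (T ∩ R))) := by
        rw [← Measure.restrict_apply (hF hB), hμR]
    _ = μ.map (missCode C) (missCode C '' (T ∩ R)) := by rw [Measure.map_apply hF hB]
    _ = ν.map (missCode C) (missCode C '' (T ∩ R)) := by rw [hmap]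
    _ = ν (missCode C ⁻¹' (missCode C '' (T ∩ R))) := by rw [Measure.map_apply hF hB]
    _ = ν (missCode C ⁻¹' (missCode C '' (T ∩ R)) ∩ R) := by
        rw [← Measure.restrict_apply (hF hB), hνR]
    _ = ν (T ∩ R) := by rw [hpre]
    _ = ν T := by rw [← Measure.restrict_apply hT, hνR]

end Measure

/-! ### Metric test sets: small closed balls centred on a dense sequence -/

section TestBalls

variable [MetricSpace E]

/-- The test sets of a sequence `u` of centres: closed balls `closedBall (u i) (1/(k+1))`,
enumerated by `ℕ` through `Nat.unpair`. [folklore] -/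
def testBall (u : ℕ → E) (n : ℕ) : Set E :=
  Metric.closedBall (u n.unpair.1) (1 / ((n.unpair.2 : ℝ) + 1))

/-- Test balls are closed. [folklore] -/
theorem isClosed_testBall (u : ℕ → E) (n : ℕ) : IsClosed (testBall u n) :=
  Metric.isClosed_closedBall

/-- **Test balls separate points from closed sets**: if the centres are dense, every point
outside a closed set `K` lies in a test ball avoiding `K`. [folklore] -/
theorem exists_mem_testBall_disjoint {u : ℕ → E} (hu : DenseRange u) {K : Set E}
    (hK : IsClosed K) {x : E} (hx : x ∉ K) : ∃ n, x ∈ testBall u n ∧ Disjoint K (testBall u n) := by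
  obtain ⟨ε, hε, hball⟩ := Metric.isOpen_iff.1 hK.isOpen_compl x hx
  obtain ⟨k, hk⟩ := exists_nat_one_div_lt (half_pos hε)
  have hk0 : (0 : ℝ) < 1 / ((k : ℝ) + 1) := by positivity
  obtain ⟨i, hi⟩ : ∃ i, dist x (u i) < 1 / ((k : ℝ) + 1) := by
    have := hu.exists_dist_lt x hk0
    exact this
  refine ⟨Nat.pair i k, ?_, ?_⟩
  · simp only [testBall, Nat.unpair_pair, Metric.mem_closedBall]
    exact hi.le
  · rw [Set.disjoint_iff]
    rintro y ⟨hyK, hy⟩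
    simp only [testBall, Nat.unpair_pair, Metric.mem_closedBall] at hy
    refine hball ?_ hyK
    rw [Metric.mem_ball]
    calc dist y x ≤ dist y (u i) + dist x (u i) := dist_triangle_right _ _ _
      _ < 1 / ((k : ℝ) + 1) + 1 / ((k : ℝ) + 1) := add_lt_add_of_le_of_lt hy hi
      _ < ε := by linarith

/-- With dense centres, the avoidance code of the test balls determines the (compact) trace. [folklore] -/
theorem range_eq_of_missCode_testBall_eq {u : ℕ → E} (hu : DenseRange u) {c₁ c₂ : CurveClass E}
    (h : missCode (testBall u) c₁ = missCode (testBall u) c₂) : c₁.range = c₂.range := by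
  -- a symmetric argument: no point of one trace lies outside the other
  suffices key : ∀ {d₁ d₂ : CurveClass E},
      missCode (testBall u) d₁ = missCode (testBall u) d₂ → d₁.range ⊆ d₂.range from
    (key h).antisymm (key h.symm)
  intro d₁ d₂ hd x hx
  by_contra hx₂
  obtain ⟨n, hxn, hdisj⟩ := exists_mem_testBall_disjoint hu d₂.isCompact_range.isClosed hx₂
  have h₂ : missCode (testBall u) d₂ n = true := missCode_eq_true_iff.2 hdisj
  have h₁ : missCode (testBall u) d₁ n = true := by rw [hd]; exact h₂
  exact Set.disjoint_left.1 (missCode_eq_true_iff.1 h₁) hx hxn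

/-- With dense centres, the avoidance code of the test balls is injective on simple classes with
a fixed starting point. [folklore] -/
theorem injOn_missCode_testBall {u : ℕ → E} (hu : DenseRange u) (a : E) :
    InjOn (missCode (testBall u)) (simple ∩ {c : CurveClass E | c.source = a}) :=
  fun _ h₁ _ h₂ h ↦ injOn_range_simple a h₁ h₂ (range_eq_of_missCode_testBall_eq hu h)

end TestBalls

/-! ### Laws of random simple curves are determined by avoidance probabilities -/

namespace Measure

variable [MetricSpace E] [CompleteSpace E] [SecondCountableTopology E]

/-- **Laws of random simple curves with a common starting point are determined by the
avoidance probabilities of the trace.** Two finite Borel measures on `CurveClass E` (`E` a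
complete separable metric space), both carried by simple classes starting at `a`, which give the
same mass to every avoidance event `{c | c.range ∩ C = ∅}` (`C` closed; `C = ∅` gives the total
mass), are equal. Simplicity is a Borel event by `CurveClass.measurableSet_simple'`
(`SimpleCurves`). This is the curve-space form of [LSW] Lemma 3.2 (p. 10) behind "the only
measure supported on simple curves … is the law of chordal SLE_{8/3}" (p. 5). [folklore] -/
theorem ext_of_simple {μ ν : Measure (CurveClass E)} [IsFiniteMeasure μ] [IsFiniteMeasure ν]
    {a : E} (hμ : ∀ᵐ c ∂μ, c ∈ simple) (hμa : ∀ᵐ c ∂μ, c.source = a)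
    (hν : ∀ᵐ c ∂ν, c ∈ simple) (hνa : ∀ᵐ c ∂ν, c.source = a)
    (h : ∀ C : Set E, IsClosed C → μ (rangeSubset Cᶜ) = ν (rangeSubset Cᶜ)) : μ = ν := by
  -- `E` is nonempty as soon as there is a curve; otherwise both measures live on an empty type
  rcases isEmpty_or_nonempty E with hE | hE
  · haveI : IsEmpty (CurveClass E) := ⟨fun c ↦ hE.elim c.source⟩
    rw [Measure.eq_zero_of_isEmpty μ, Measure.eq_zero_of_isEmpty ν]
  obtain ⟨u, hu⟩ := TopologicalSpace.exists_dense_seq E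
  have hR : MeasurableSet (simple ∩ {c : CurveClass E | c.source = a}) :=
    measurableSet_simple'.inter (isClosed_eq continuous_source continuous_const).measurableSet
  refine ext_of_missCode_injOn (isClosed_testBall u) hR (injOn_missCode_testBall hu a) ?_ ?_
    fun s ↦ h _ ?_
  · filter_upwards [hμ, hμa] with c hc hca using ⟨hc, hca⟩
  · filter_upwards [hν, hνa] with c hc hca using ⟨hc, hca⟩
  · exact Set.Finite.isClosed_biUnion s.finite_toSet fun n _ ↦ isClosed_testBall u n

/-- The same for probability measures: it suffices to compare the avoidance probabilities of
NONEMPTY closed sets (the form used with `LawlerSchrammWerner2003_of_facts`, where the test sets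
are hulls). [folklore] -/
theorem ext_of_simple_of_isProbabilityMeasure
    {μ ν : Measure (CurveClass E)} [IsProbabilityMeasure μ] [IsProbabilityMeasure ν] {a : E}
    (hμ : ∀ᵐ c ∂μ, c ∈ simple) (hμa : ∀ᵐ c ∂μ, c.source = a)
    (hν : ∀ᵐ c ∂ν, c ∈ simple) (hνa : ∀ᵐ c ∂ν, c.source = a)
    (h : ∀ C : Set E, IsClosed C → C.Nonempty → μ (rangeSubset Cᶜ) = ν (rangeSubset Cᶜ)) :
    μ = ν := by
  refine ext_of_simple hμ hμa hν hνa fun C hC ↦ ?_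
  rcases C.eq_empty_or_nonempty with rfl | hne
  · rw [compl_empty, show (rangeSubset univ : Set (CurveClass E)) = univ from
      eq_univ_of_forall fun c ↦ subset_univ _, measure_univ, measure_univ]
  · exact h C hC hne

end Measure

end CurveClass

end Literature.Probability.RandomPlanarGeometry

end
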